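import Summits.QuantumFields.YangMills.Theorems.UnitScaleTiltProp7KinvRowOfConjLetters
import Summits.QuantumFields.YangMills.Theorems.UnitScaleTiltProp7KCoerciveFamilyOfInterpolant
import Summits.QuantumFields.YangMills.Theorems.UnitScaleTiltProp7TransportedInterpolantRowsAllMembers
import Summits.QuantumFields.YangMills.Theorems.UnitScaleTiltProp7OneFormCoerciveHolds
import Summits.QuantumFields.YangMills.Theorems.UnitScaleTiltProp7CoerciveOfNormG0
import Summits.QuantumFields.YangMills.Theorems.UnitScaleTiltProp7ConjResolventEtaFamilyOfGreenBlockSup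
import Summits.QuantumFields.YangMills.Theorems.UnitScaleTiltProp7KinvWindowRLInhabited
import HarnessLib

/-!
# Route `UnitScaleTilt`, crux K1 «MinimiserStabilityRegPr» (stmt-QuantumFields-19200), EX face — K-STOREY, FILE (K6-η-R = THE η-SLOT CLOSURE KNIT, ROOM-FREE `_allMembers` EDITION of
# ✓`Prop7KinvEtaFamilyPackage` — the SAME statement with the ROOM antecedent `2(12ℓ+5) ≤ sitesPerDir` DELETED, px13's interpolant rows replaced by px5's (R6) cover-reading edition
# ✓`Prop7TransportedInterpolantRowsAllMembers.exists_transportedInterpolant_rows_kfree_allMembers` (no `hwrap`); ★p1 g28 WORD №47 (c), ★★OWNER 17cz):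
# **THE COARSE ENTRY ROW `hKinv`(η) OF `K₀⁻¹ = (Q_kG₀Q_k†)⁻¹` FOR ALL MEMBERS, AS ONE `∃`-PACKAGE OVER LANDED `∃`-PACKAGES** — the common input of BOTH cones (Π ✓`Prop7KinvPiOfCone`,
# Δ₁ ✓`Prop7KinvSlotOfCone`) and hence of the EX rows `h133`, `h137kπ` (✓`Prop7PiSlotRowsOfCone`), `norm_H₁`, `hCk`, `h137kΔ`

Cell `ym3-torus` (HUMAN RULING D-0037; rung R3 = SU(2) YM₃ on T³ — NOT d = 4, NOT infinite volume, NOT a mass gap, NOT Clay).  Width seat `ym3-torus-px10` (gen 14; FREE px; R-edition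
2026-08-30 14:35Z, generated from ✓p775390's bytes by script: ROOM lines deleted, one supplier swapped).  THEOREMS ONLY (0 `def`, 0 `sorry`, default heartbeats); `--supports stmt-QuantumFields-19200 --as helper`; count-neutral.

THE INPUTS, ALL LANDED, BY NAME.  The Idx DOOR px10 g13 ✓p770187 §3 `Prop7KinvRowOfConjLetters.kinvRow_family_of_coercive_of_conjResolvent` (letters `hpos`, `hKco` = m₀, `hG` = B_G, `hres` = δ₃,
window (R_L)) fed: (m₀) px10 ✓p770754 `Prop7KCoerciveFamilyOfInterpolant.hKco_family_of_interpolant_rows` ∘ px5 (R6) ✓`Prop7TransportedInterpolantRowsAllMembers.exists_transportedInterpolant_rows_kfree_allMembers`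
(`C₁ = 45`, `C_D = 33·10⁸`, ABSOLUTE; `hslot = 0` and `hΔs` ✓`DeltaEtaSlot_isSymmetric` at η); (B_G, hpos) ★p1 (γ) ✓`Prop7OneFormCoerciveHolds.hco_DeltaEtaSlot_exists` + ✓`norm_GT_le_of_coercive` +
✓`posOnto_of_coercive`; (δ₃) px12 ✓`Prop7ConjResolventEtaFamilyOfGreenBlockSup.conj_resolvent_DeltaEtaSlot_family_exists` (⟸ ✓p772864 ∘ px16 ✓p772637 (Gb)-FAMILY); (R_L) px12
✓`Prop7KinvWindowRLInhabited.exists_slope_family_RL` (the window is a CHOICE of the slope `μ`, pure reals).  m₀ is L-free: `m₀ = (4·(33·10⁸ + 32√2·648·45² + 9a₁∕4))⁻¹`.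
THE THREAD (ROOM-FREE).  `Lift(i, U₀)` (the suppliers' antecedent of record) ∧ the coupling window `a₀(c₀ L∕cB L)ℓ³ ≤ a ≤ a₁(c₀ L∕cB L)ℓ³`; the door and (m₀) take a coupling FUNCTION `a L i`, so for a given real `a` the
knit runs them on the CLAMPED function `(L′, i′) ↦ max (a₀t′) (min a (a₁t′))` (always in the window, `= a` at the member) — no hypothesis leaks across members.
WHAT IS PROVED (ns `Summit.QuantumFields.YangMills.Theorems.Prop7KinvEtaFamilyPackage`).
* ★★★ `kinvRow_eta_family_exists_allMembers` — for positive L-only weights `c₀ cB` and a coupling window `0 < a₀ ≤ a₁` THERE ARE L-only `αK CK μK : ℕ → ℝ` (cap with the three windows of record and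
  `αK ≤ 1`, constant `≥ 0`, rate `> 0`) such that for every `L > 1`, member `i : Idx L`, background `U₀` with `RegPr ρ U₀`, `ρ ≤ αK L`, under `Lift` (NO ROOM), and every coupling `a` in
  the window: THE DOORS' `hKinv`(η) TEXT — `‖toL2B⁻¹(KinvT … a (DeltaEtaSlot …) U₀ (toL2B δ_yZ))(y′)‖ ≤ CK L·((c₀ L∕cB L)·ℓ³)·e^{−μK L·tdist(ŷ′, ŷ)}·‖Z‖` — i.e. the `hKinv` input of
  ✓`kinvRow_pi_family_of_cone` ∕ ✓`kinvRow_slot_family_of_cone` ∕ ✓`kinvRow_pi_family_of_blockLetters` (thread `Λ := Lift ∧ window`) with NO letter left displayed at the η-slot — EVERY member, small ones included.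
HYP-SAT (★★OWNER №42).  Every input is a landed theorem; the statement's antecedents are `RegPr`∕cap∕`Lift`∕coupling window only — all inhabited on the literal families; non-vacuous.  HONEST SCOPE.  An `∃`-assembly; no estimate of print is proved HERE (they are proved in the inputs);
nothing of the Π∕Δ₁ letters, `h133`, EX or the crux is proved; the Yang–Mills mass gap is NOT proved.

References: T. Bałaban, CMP **99** (1985) 389–434 [Balaban1985BackgroundPropagators] ((3.132) p.422, Thm 3.1 (3.46)–(3.49) pp.398–399, Thm 3.11 p.416, (3.19) p.393);
CMP **102** (1985) 277–309 [Balaban1985Variational] (Thm 1 p.279, (45)–(46) p.285).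
-/

set_option autoImplicit false

noncomputable section

open scoped BigOperators Matrix.Norms.L2Operator InnerProductSpace ComplexConjugate

namespace Summit.QuantumFields.YangMills.Theorems.Prop7KinvEtaFamilyPackageAllMembers

open Literature.MathematicalPhysics.QuantumFieldTheory.Balaban1983to89
open Literature.MathematicalPhysics.QuantumFieldTheory.Balaban1983to89.T3ContinuumYM3Torus
open Literature.MathematicalPhysics.QuantumFieldTheory.Balaban1983to89.T3Thm1Carrier
open T3PrintedRegularMinimiser (RegPr)
open T3PrintedMinimiserExistence (regPr_mono)
open T3PrintedRegularOrbits (sites_eq)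
open T3LevelShift (siteShift)
open T3SectALandauChart (formComp bgUnits eta)
open B15DeterminingSets (embIter)
open B9Eq311L2Pairing (WL2)
open B11Eq103H1Complex (BondL2K)
open B5Eq118OneStroke (iterBlockOf)
open Summit.QuantumFields.YangMills.Theorems.Prop8Chart (emlIterU)
open Summit.QuantumFields.YangMills.Theorems.Prop7SectET3Transport (periodsT3)
open Summit.QuantumFields.YangMills.Theorems.Prop7SectET3HilbertLetters (W₂ toL2 toL2S toL2B DL2)
open Summit.QuantumFields.YangMills.Theorems.Prop7SectET3WilsonHessian (DeltaEta DeltaEtaSlot DeltaEtaSlot_apply)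
open Summit.QuantumFields.YangMills.Theorems.Prop7SectET3CurvedPropagators (Qk GT KinvT PosOnto)
open Summit.QuantumFields.YangMills.Theorems.Prop7KinvRowOfConjLetters (kinvRow_family_of_coercive_of_conjResolvent)
open Summit.QuantumFields.YangMills.Theorems.Prop7KCoerciveFamilyOfInterpolant (hKco_family_of_interpolant_rows)
open Summit.QuantumFields.YangMills.Theorems.Prop7TransportedInterpolantRowsAllMembers (exists_transportedInterpolant_rows_kfree_allMembers)
open Summit.QuantumFields.YangMills.Theorems.Prop7OneFormCoerciveHolds (hco_DeltaEtaSlot_exists norm_GT_le_of_coercive posOnto_of_coercive)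
open Summit.QuantumFields.YangMills.Theorems.Prop7CoerciveOfNormG0 (DeltaEtaSlot_isSymmetric)
open Summit.QuantumFields.YangMills.Theorems.Prop7ConjResolventEtaFamilyOfGreenBlockSup (conj_resolvent_DeltaEtaSlot_family_exists)
open Summit.QuantumFields.YangMills.Theorems.Prop7KinvWindowRLInhabited (exists_slope_family_RL)

/-- ★★★ **THE `hKinv`(η) `∃`-PACKAGE: THE COARSE ENTRY ROW OF `(Q_kG₀Q_k†)⁻¹` FOR ALL MEMBERS WITH L-ONLY CONSTANTS.**  For positive L-only weights `c₀ cB` and a coupling window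
`0 < a₀ ≤ a₁` there are `αK CK μK : ℕ → ℝ` with `0 < αK L`, `10¹²L³αK L ≤ 1`, `10¹⁰L⁶αK L ≤ 1`, `13·10¹⁴L³αK L ≤ 1`, `αK L ≤ 1`, `0 ≤ CK L`, `0 < μK L`, and: for every `L > 1`,
member `i : Idx L`, background `U₀` with `RegPr ρ U₀`, `ρ ≤ αK L`, under `Lift` (every member — NO ROOM), and coupling `a₀(c₀ L∕cB L)ℓ³ ≤ a ≤ a₁(c₀ L∕cB L)ℓ³`:
`∀ y Z y′, ‖toL2B⁻¹(KinvT … a (DeltaEtaSlot …) U₀ (toL2B δ_yZ))(y′)‖ ≤ CK L·((c₀ L∕cB L)·ℓ³)·e^{−μK L·tdist(ŷ′, ŷ)}·‖Z‖` (print's (3.132) «`|(QGQ*)⁻¹(y, y′)| ≤ O(1)e^{−δd}`», uniform in `K`).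
[cite: Balaban1985BackgroundPropagators, (3.132) p.422, Thm 3.1 p.398, Thm 3.11 p.416; Balaban1985Variational, Thm 1 p.279] -/
theorem kinvRow_eta_family_exists_allMembers (c₀ cB : ℕ → ℝ) [hc₀ : ∀ L : ℕ, Fact (0 < c₀ L)] [hcB : ∀ L : ℕ, Fact (0 < cB L)] {a₀ a₁ : ℝ} (ha₀ : 0 < a₀) (ha₀₁ : a₀ ≤ a₁) :
    ∃ (αK CK μK : ℕ → ℝ),
      (∀ L : ℕ, 1 < L → 0 < αK L) ∧ (∀ L : ℕ, 1 < L → 10 ^ 12 * (L : ℝ) ^ 3 * αK L ≤ 1) ∧ (∀ L : ℕ, 1 < L → 10 ^ 10 * (L : ℝ) ^ 6 * αK L ≤ 1) ∧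
      (∀ L : ℕ, 1 < L → 13 * 10 ^ 14 * (L : ℝ) ^ 3 * αK L ≤ 1) ∧ (∀ L : ℕ, 1 < L → αK L ≤ 1) ∧ (∀ L : ℕ, 1 < L → 0 ≤ CK L) ∧ (∀ L : ℕ, 1 < L → 0 < μK L) ∧
    ∀ (L : ℕ), 1 < L → ∀ (i : Idx L) (U₀ : GaugeField (i.1.1.P i.1.2.2) 0 (Matrix.specialUnitaryGroup (Fin 2) ℂ)), ∀ ρ : ℝ, RegPr i.1.1 i.1.2.1 i.1.2.2 ρ U₀ → ρ ≤ αK L →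
        (∀ cf : Site (i.1.1.P i.1.2.2) (i.1.2.2 - i.1.2.1) → Matrix (Fin 2) (Fin 2) ℂ,
        (∀ e' : PBond (i.1.1.P i.1.2.2) (i.1.2.2 - i.1.2.1), cf e'.src = ((emlIterU (i.1.2.2 - i.1.2.1) (bgUnits i.1.1 i.1.2.2 U₀) e' : (Matrix (Fin 2) (Fin 2) ℂ)ˣ) : Matrix (Fin 2) (Fin 2) ℂ) * cf e'.tgt *
        (((emlIterU (i.1.2.2 - i.1.2.1) (bgUnits i.1.1 i.1.2.2 U₀) e')⁻¹ : (Matrix (Fin 2) (Fin 2) ℂ)ˣ) : Matrix (Fin 2) (Fin 2) ℂ)) →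
        ∃ l₀ : Site (i.1.1.P i.1.2.2) 0 → Matrix (Fin 2) (Fin 2) ℂ,
        (∀ b' : PBond (i.1.1.P i.1.2.2) 0, l₀ b'.src = ((bgUnits i.1.1 i.1.2.2 U₀ b' : (Matrix (Fin 2) (Fin 2) ℂ)ˣ) : Matrix (Fin 2) (Fin 2) ℂ) * l₀ b'.tgt * (((bgUnits i.1.1 i.1.2.2 U₀ b')⁻¹ : (Matrix (Fin 2) (Fin 2) ℂ)ˣ) : Matrix (Fin 2) (Fin 2) ℂ)) ∧
        ∀ y : Site (i.1.1.P i.1.2.2) (i.1.2.2 - i.1.2.1), l₀ (embIter (i.1.2.2 - i.1.2.1) y) = cf y) →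
      ∀ a : ℝ, a₀ * (c₀ L / cB L) * ((i.1.1.L : ℝ) ^ (i.1.2.2 - i.1.2.1)) ^ 3 ≤ a → a ≤ a₁ * (c₀ L / cB L) * ((i.1.1.L : ℝ) ^ (i.1.2.2 - i.1.2.1)) ^ 3 →
      ∀ (y : PBond (i.1.1.P i.1.2.1) 0) (Z : Matrix (Fin 2) (Fin 2) ℂ) (y' : PBond (i.1.1.P i.1.2.1) 0),
        ‖(toL2B i.1.1 i.1.2.1 (cB L)).symm (KinvT i.1.1 i.1.2.1 i.1.2.2 i.2.2.le (c₀ L) (cB L) a (DeltaEtaSlot i.1.1 i.1.2.1 i.1.2.2 (c₀ L)) U₀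
            (toL2B i.1.1 i.1.2.1 (cB L) (Pi.single y Z))) y'‖
          ≤ CK L * ((c₀ L / cB L) * ((L : ℝ) ^ (i.1.2.2 - i.1.2.1)) ^ 3)
              * Real.exp (-(μK L * (Site.tdist (siteShift (sites_eq i.1.1 i.1.2.1 i.1.2.2 i.2.2.le) y'.src) (siteShift (sites_eq i.1.1 i.1.2.1 i.1.2.2 i.2.2.le) y.src) : ℝ))) * ‖Z‖ := by
  classical
  -- the landed ∃-packages
  obtain ⟨αco, γco, hαco, hWco, hwinco, hγco, hco⟩ := hco_DeltaEtaSlot_exists c₀ cB ha₀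
  obtain ⟨αδ, BV, δG, hαδ, hWδ, hWδ', hWδ'', hBV, hδG, hres⟩ := conj_resolvent_DeltaEtaSlot_family_exists c₀ cB ha₀ ha₀₁
  -- the L-free coercivity constant of `K₀` and the L-only `B_G`
  have ha₁ : 0 ≤ a₁ := ha₀.le.trans ha₀₁
  set m₀ : ℕ → ℝ := fun _ => (4 * (33 * 10 ^ 8 + (32 * Real.sqrt 2 * 648 + 0) * 45 ^ 2 + 9 / 4 * a₁))⁻¹ with hm₀
  have hm₀pos : ∀ L : ℕ, 1 < L → 0 < m₀ L := fun L _ => by rw [hm₀]; positivity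
  set BG : ℕ → ℝ := fun L => (γco L)⁻¹ with hBGd
  -- the slope (the (R_L) window is a choice of `μ`)
  obtain ⟨μ, hμ0, hμδ, hδ₃0, hR⟩ := exists_slope_family_RL m₀ BG BV δG hm₀pos hBV hδG
  set δ₃ : ℕ → ℝ := fun L => 2 * ((BV L * (μ L * (2 / (δG L - μ L) + 6) * Real.exp (6 * μ L))) * (2 * (1 + 2 / (δG L - μ L))) ^ 3) with hδ₃d
  -- the cap
  set αK : ℕ → ℝ := fun L => min (min (αco L) (αδ L)) (min (10 ^ 10 * (L : ℝ) ^ 6)⁻¹ 1) with hαK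
  have hαK0 : ∀ L : ℕ, 1 < L → 0 < αK L := fun L hL => by
    have hL0 : (0 : ℝ) < L := by exact_mod_cast lt_trans zero_lt_one hL
    have := hαco L hL; have := hαδ L hL
    simp only [hαK]; exact lt_min (lt_min (by assumption) (by assumption)) (lt_min (by positivity) one_pos)
  have hαK_co : ∀ L, αK L ≤ αco L := fun L => by simp only [hαK]; exact (min_le_left _ _).trans (min_le_left _ _)
  have hαK_δ : ∀ L, αK L ≤ αδ L := fun L => by simp only [hαK]; exact (min_le_left _ _).trans (min_le_right _ _)
  have hαK_1 : ∀ L, αK L ≤ 1 := fun L => by simp only [hαK]; exact (min_le_right _ _).trans (min_le_right _ _)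
  have hW10 : ∀ L : ℕ, 1 < L → 10 ^ 10 * (L : ℝ) ^ 6 * αK L ≤ 1 := fun L hL => by
    have hL0 : (0 : ℝ) < L := by exact_mod_cast lt_trans zero_lt_one hL
    have h1 : αK L ≤ (10 ^ 10 * (L : ℝ) ^ 6)⁻¹ := by simp only [hαK]; exact (min_le_right _ _).trans (min_le_left _ _)
    calc 10 ^ 10 * (L : ℝ) ^ 6 * αK L ≤ 10 ^ 10 * (L : ℝ) ^ 6 * (10 ^ 10 * (L : ℝ) ^ 6)⁻¹ := mul_le_mul_of_nonneg_left h1 (by positivity)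
      _ = 1 := mul_inv_cancel₀ (by positivity)
  have hW12 : ∀ L : ℕ, 1 < L → 10 ^ 12 * (L : ℝ) ^ 3 * αK L ≤ 1 := fun L hL => by
    have hL0 : (0 : ℝ) < L := by exact_mod_cast lt_trans zero_lt_one hL
    exact (mul_le_mul_of_nonneg_left (hαK_co L) (by positivity)).trans (hWco L hL)
  have hW13 : ∀ L : ℕ, 1 < L → 13 * 10 ^ 14 * (L : ℝ) ^ 3 * αK L ≤ 1 := fun L hL => by
    have hL0 : (0 : ℝ) < L := by exact_mod_cast lt_trans zero_lt_one hL
    exact (mul_le_mul_of_nonneg_left (hαK_co L) (by positivity)).trans (hwinco L hL)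
  refine ⟨αK, fun L => 2 * Real.sqrt 2 * Real.exp (3 * μ L) / m₀ L, μ, hαK0, hW12, hW10, hW13, fun L _ => hαK_1 L,
    fun L hL => by have := hm₀pos L hL; positivity, hμ0, ?_⟩
  intro L hL i U₀ ρ hreg hρ hlift a ha₀a ha₁a y Z y'
  -- the clamped coupling function: in every member's window, `= a` here
  obtain ⟨af, haf⟩ : ∃ f : ∀ L' : ℕ, Idx L' → ℝ, ∀ (L' : ℕ) (i' : Idx L'),
      f L' i' = max (a₀ * (c₀ L' / cB L') * ((i'.1.1.L : ℝ) ^ (i'.1.2.2 - i'.1.2.1)) ^ 3) (min a (a₁ * (c₀ L' / cB L') * ((i'.1.1.L : ℝ) ^ (i'.1.2.2 - i'.1.2.1)) ^ 3)) :=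
    ⟨_, fun _ _ => rfl⟩
  have ht0 : ∀ (L' : ℕ) (i' : Idx L'), 0 ≤ (c₀ L' / cB L') * ((i'.1.1.L : ℝ) ^ (i'.1.2.2 - i'.1.2.1)) ^ 3 := fun L' i' =>
    mul_nonneg (div_nonneg (hc₀ L').out.le (hcB L').out.le) (pow_nonneg (pow_nonneg (Nat.cast_nonneg _) _) _)
  have haf_lo : ∀ (L' : ℕ) (i' : Idx L'), a₀ * (c₀ L' / cB L') * ((i'.1.1.L : ℝ) ^ (i'.1.2.2 - i'.1.2.1)) ^ 3 ≤ af L' i' := fun L' i' => by rw [haf]; exact le_max_left _ _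
  have haf_hi : ∀ (L' : ℕ) (i' : Idx L'), af L' i' ≤ a₁ * (c₀ L' / cB L') * ((i'.1.1.L : ℝ) ^ (i'.1.2.2 - i'.1.2.1)) ^ 3 := fun L' i' => by
    rw [haf]
    refine max_le ?_ (min_le_right _ _)
    have := ht0 L' i'
    rw [mul_assoc, mul_assoc]; exact mul_le_mul_of_nonneg_right ha₀₁ this
  have haf0 : ∀ (L' : ℕ) (i' : Idx L'), 0 ≤ af L' i' := fun L' i' => le_trans (by have := ht0 L' i'; rw [mul_assoc]; positivity) (haf_lo L' i')
  have hafU : ∀ (L' : ℕ), 1 < L' → ∀ i' : Idx L', af L' i' ≤ a₁ * ((c₀ L' / cB L') * ((L' : ℝ) ^ (i'.1.2.2 - i'.1.2.1)) ^ 3) := fun L' _ i' => by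
    have e : (i'.1.1.L : ℝ) = (L' : ℝ) := by rw [i'.2.1]
    have := haf_hi L' i'
    rw [e, mul_assoc] at this; exact this
  have hafa : af L i = a := by
    rw [haf, min_eq_left ha₁a, max_eq_right ha₀a]
  -- the thread `Lift`
  obtain ⟨Λ, hΛ⟩ : ∃ Λ : ∀ (L' : ℕ) (i' : Idx L'), GaugeField (i'.1.1.P i'.1.2.2) 0 (Matrix.specialUnitaryGroup (Fin 2) ℂ) → Prop, ∀ L' i' U₀', Λ L' i' U₀' ↔
      ((∀ cf : Site (i'.1.1.P i'.1.2.2) (i'.1.2.2 - i'.1.2.1) → Matrix (Fin 2) (Fin 2) ℂ,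
        (∀ e' : PBond (i'.1.1.P i'.1.2.2) (i'.1.2.2 - i'.1.2.1), cf e'.src = ((emlIterU (i'.1.2.2 - i'.1.2.1) (bgUnits i'.1.1 i'.1.2.2 U₀') e' : (Matrix (Fin 2) (Fin 2) ℂ)ˣ) : Matrix (Fin 2) (Fin 2) ℂ) * cf e'.tgt *
        (((emlIterU (i'.1.2.2 - i'.1.2.1) (bgUnits i'.1.1 i'.1.2.2 U₀') e')⁻¹ : (Matrix (Fin 2) (Fin 2) ℂ)ˣ) : Matrix (Fin 2) (Fin 2) ℂ)) →
        ∃ l₀ : Site (i'.1.1.P i'.1.2.2) 0 → Matrix (Fin 2) (Fin 2) ℂ,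
        (∀ b' : PBond (i'.1.1.P i'.1.2.2) 0, l₀ b'.src = ((bgUnits i'.1.1 i'.1.2.2 U₀' b' : (Matrix (Fin 2) (Fin 2) ℂ)ˣ) : Matrix (Fin 2) (Fin 2) ℂ) * l₀ b'.tgt * (((bgUnits i'.1.1 i'.1.2.2 U₀' b')⁻¹ : (Matrix (Fin 2) (Fin 2) ℂ)ˣ) : Matrix (Fin 2) (Fin 2) ℂ)) ∧
        ∀ y : Site (i'.1.1.P i'.1.2.2) (i'.1.2.2 - i'.1.2.1), l₀ (embIter (i'.1.2.2 - i'.1.2.1) y) = cf y)) := ⟨_, fun _ _ _ => Iff.rfl⟩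
  -- member-level facts under the thread at the cap
  have hmem : ∀ (L' : ℕ), 1 < L' → ∀ (i' : Idx L') (U₀' : GaugeField (i'.1.1.P i'.1.2.2) 0 (Matrix.specialUnitaryGroup (Fin 2) ℂ)) (ρ' : ℝ),
      RegPr i'.1.1 i'.1.2.1 i'.1.2.2 ρ' U₀' → ρ' ≤ αK L' → Λ L' i' U₀' →
        (13 * 10 ^ 14 * (i'.1.1.L : ℝ) ^ 3 * ρ' ≤ 1) ∧
        (∀ v, γco L' * ‖v‖ ^ 2 ≤ RCLike.re ⟪v, Prop7SectET3CurvedPropagators.laplaceA i'.1.1 i'.1.2.1 i'.1.2.2 i'.2.2.le (c₀ L') (cB L') (af L' i')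
            (DeltaEtaSlot i'.1.1 i'.1.2.1 i'.1.2.2 (c₀ L')) U₀' v⟫_ℂ) := by
    intro L' hL' i' U₀' ρ' hreg' hρ' hl'
    have e : (i'.1.1.L : ℝ) = (L' : ℝ) := by rw [i'.2.1]
    refine ⟨?_, fun v => hco L' hL' i' U₀' ρ' hreg' (hρ'.trans (hαK_co L')) ((hΛ L' i' U₀').mp hl') (af L' i') (haf_lo L' i') v⟩
    rw [e]
    have hL0 : (0 : ℝ) < L' := by exact_mod_cast lt_trans zero_lt_one hL'
    calc 13 * 10 ^ 14 * (L' : ℝ) ^ 3 * ρ' ≤ 13 * 10 ^ 14 * (L' : ℝ) ^ 3 * αK L' := mul_le_mul_of_nonneg_left hρ' (by positivity)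
      _ ≤ 1 := hW13 L' hL'
  -- the Idx door with its four letter families
  have key := kinvRow_family_of_coercive_of_conjResolvent αK hαK0 hW10 hW12 c₀ cB af
    (fun L' i' => DeltaEtaSlot i'.1.1 i'.1.2.1 i'.1.2.2 (c₀ L')) Λ m₀ BG μ δ₃ hm₀pos
    (fun L' hL' => by rw [hBGd]; exact (inv_pos.mpr (hγco L' hL')).le) (fun L' hL' => (hμ0 L' hL').le) (fun L' hL' => by rw [hδ₃d]; exact hδ₃0 L' hL')
    (fun L' hL' i' U₀' ρ' hreg' hρ' hl' => by
      obtain ⟨hw, hc⟩ := hmem L' hL' i' U₀' ρ' hreg' hρ' hl'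
      exact posOnto_of_coercive i'.2.2.le (cB L') i'.2.2 hreg' hw (hγco L' hL') _ hc)
    (hKco_family_of_interpolant_rows αK hαK0 (fun L' hL' => hαK_1 L') c₀ cB af (fun _ => a₁) haf0 hafU
      (fun L' i' => DeltaEtaSlot i'.1.1 i'.1.2.1 i'.1.2.2 (c₀ L')) Λ (fun _ => 45) (fun _ => 33 * 10 ^ 8) (fun _ => 0)
      (fun L' _ => by norm_num) (fun L' _ => le_rfl)
      (fun L' hL' i' U₀' ρ' hreg' hρ' hl' => by
        obtain ⟨hw, hc⟩ := hmem L' hL' i' U₀' ρ' hreg' hρ' hl'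
        exact posOnto_of_coercive i'.2.2.le (cB L') i'.2.2 hreg' hw (hγco L' hL') _ hc)
      (fun L' hL' i' U₀' ρ' hreg' hρ' hl' => DeltaEtaSlot_isSymmetric (F := i'.1.1) (n := i'.1.2.1) (K := i'.1.2.2) (c₀ := c₀ L') U₀')
      (fun L' hL' i' U₀' ρ' hreg' hρ' hl' v => by
        rw [LinearMap.sub_apply, DeltaEtaSlot_apply, ContinuousLinearMap.coe_coe, sub_self, inner_zero_right, map_zero, zero_mul])
      (fun L' hL' i' U₀' ρ' hreg' hρ' hl' => by
        have e : (i'.1.1.L : ℝ) = (L' : ℝ) := by rw [i'.2.1]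
        have hεw : 10 ^ 10 * (i'.1.1.L : ℝ) ^ 6 * αK L' ≤ 1 := by rw [e]; exact hW10 L' hL'
        have hεw' : 10 ^ 12 * (i'.1.1.L : ℝ) ^ 3 * αK L' ≤ 1 := by rw [e]; exact hW12 L' hL'
        obtain ⟨E, h1, h2, h3⟩ := exists_transportedInterpolant_rows_kfree_allMembers i'.1.1 i'.1.2.1 i'.1.2.2 i'.2.2.le (c₀ L') (cB L') (hαK0 L' hL') hεw hεw' U₀'
          (regPr_mono (F := i'.1.1) hρ' hreg') i'.2.2
        refine ⟨E, h1, fun c => ?_, fun c => ?_⟩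
        · have := h2 c; rw [e] at this; exact this
        · have := h3 c; rw [e] at this; exact this))
    (fun L' hL' i' U₀' ρ' hreg' hρ' hl' x => by
      obtain ⟨hw, hc⟩ := hmem L' hL' i' U₀' ρ' hreg' hρ' hl'
      have := norm_GT_le_of_coercive i'.2.2.le (cB L') i'.2.2 hreg' hw (hγco L' hL') _ hc x
      rw [hBGd]; exact this)
    (fun L' hL' i' U₀' ρ' hreg' hρ' hl' φ hφ Mf Mfi hMf hMfi x => by
      rw [hδ₃d]
      exact hres μ (fun L'' hL'' => (hμ0 L'' hL'').le) hμδ L' hL' i' U₀' ρ' hreg' (hρ'.trans (hαK_δ L')) ((hΛ L' i' U₀').mp hl') (af L' i')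
        (haf_lo L' i') (haf_hi L' i') φ hφ Mf Mfi hMf hMfi x)
    (fun L' hL' => by rw [hδ₃d, hBGd]; exact hR L' hL')
    L hL i U₀ ρ hreg hρ ((hΛ L i U₀).mpr hlift) y Z y'
  rw [hafa] at key
  exact key

end Summit.QuantumFields.YangMills.Theorems.Prop7KinvEtaFamilyPackageAllMembers

end
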